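import Literature.MathematicalPhysics.QuantumFieldTheory.Balaban1983to89.B8Thm4ExistsAtGammaRec
import Literature.MathematicalPhysics.QuantumFieldTheory.Balaban1983to89.B8Ineq133CubeMemberGammaRec
import Literature.MathematicalPhysics.QuantumFieldTheory.Balaban1983to89.B8DentedCubeMemberZdRec
import Literature.MathematicalPhysics.QuantumFieldTheory.Balaban1983to89.B8Prop6DentedCubeMemberGamma

/-!
# `Balaban1983to89.B8Prop6DentedCubeMemberGammaRec` — RECORD TWIN of `B8Prop6DentedCubeMemberGamma` ([Balaban1985RegularSpaces] PROPOSITION 6 p. 99 at a DENTED cube member of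
# [Balaban1985Variational] (148)–(150): «the assumptions of Theorem 4 are satisfied for the pair 1, U₀″» and Prop. 6 ∕ (152)–(153) modulo the three existence bodies, edition γ) FOR
# THE SYMMETRISED CENTRED block averaging (0.4) of [Balaban1987RG1] — THE ROOT OF THE R6 (g) CROWN CHAIN of the «N05-REC» road

statement-level skeleton of published theorems with citation tags; proofs where landed; nothing here is a claim about the Yang–Mills mass gap

T. Bałaban, *Spaces of regular gauge field configurations on a lattice and gauge fixing conditions*, Commun. Math. Phys. **99** (1985) 75–102 `[Balaban1985RegularSpaces]`
("[6]"): Prop. 6 (1.135)–(1.138) p. 99, p. 99 (sentence after (1.133)), (1.132)–(1.133) p. 99, (1.33)–(1.35) p. 82, (1.66) p. 87, (1.15) p. 78, Thm 4 p. 88; T. Bałaban, *The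
variational problem and background fields in renormalization group method for lattice gauge theories*, Commun. Math. Phys. **102** (1985) 277–309 `[Balaban1985Variational]`
("[15]"): (148)–(153) p. 301; T. Bałaban, *Renormalization group approach to lattice gauge field theories. I*, Commun. Math. Phys. **109** (1987) 249–301 `[Balaban1987RG1]`
("[I]"): (0.3)–(0.4) pp. 252–253; [B6] = [Balaban1984PropagatorsII] (2.3) p. 224.

CITATION HEADER (lean-in-tree rule).  Cell `pub-ymgap`, «N05-REC» stage 2 (director-ym №254∕№255∕№288), item R6 row (g) ROOT — LEAD PEN dag-n05-e g38 (desk `R6-PLAN.md` §2 (g);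
inventory `N05-REC-INVENTORY.md` §R6 row `B8Prop6DentedCubeMemberGamma`: class A = `thm4_hypotheses_one_cutFixed_dented_γ inAx_lamST_of_inAx_top prop6_exists_dentedMember_at_γ₃`).
WHAT IS REPRODUCED = ✓ the engine's §2–§3 over the record inputs: (b)-2 `B8Ineq133CubeMemberGammaRec.thm4_hypotheses_one_cutFixedZ_γ` (p716224), R5 α-§2
`B8Thm4ExistsAtGammaRec.thm4Exists_concrete_at_γ`, R6-(g)-0 `B8DentedCubeMemberZdRec.{lamBPT_hbox_pred, lamBPT_hclass, bdryLayer_dented, hΩ_sq, inBox_sq_of_mem_lamST}`,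
R6-1 `B8Prop6OfThm4Rec.localGaugeZ_mem`, dag-n05-d's `B8Ineq133Rec.ineq133` ((1.15) on the whole centred tower) + `B8Eq119TwistedAxialRec.{inAxZ_one_iff, inAxOneZ_of_tower}`; the
engine's §1 cover lemma (`lamST_cover_pure ∕ inAx_lamST_of_inAx_top`) is REPLACED, as in (b)-1, by the sub-tower reading of (1.15): `inAxZ_lamST_cutFixedZ` (every dented cell
label lies in its level's centred box `□_j^{(j)} ⊂ □̃^{(j)}`).  TOKEN MAP (T1∕T2∕T5): `CubeB8D ↦ CubeB8DZ`, `cutFixed ∕ localGauge ↦ cutFixedZ ∕ localGaugeZ`, `InAx ∕ Restr129 ∕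
IsLandau138W ↦ …Z`, `avgIter ∕ linCovIter ↦ …Z`, `tlo ∕ thi ↦ B8Ineq130Rec.tlo ∕ thi`, corner boxes∕blocks ↦ CENTRED, `C0 ↦ C0Z`, `(hL : 2 ≤ L) ↦ (hLs : L = 2s+1) (hs : 1 ≤ s)`.
Declaration names = engine names (T5).  Kind «kernel-checked proof», theorems only; no `def`, no `instance`, no `notation`.  `--supports stmt-QuantumFields-20541` (K0⁷; COUNT-NEUTRAL).

HONEST SCOPE: Prop. 6 ∕ (152)–(153) at a dented record member MODULO the three displayed existence BODIES at the flat datum (Prop. 5 base∕step = Sect. E; the β-shaped (1.59)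
two-line body over `c.lamBPT m ∪ {level-0 crossing bonds}`) — the bodies are the (g) chain's business above this root; nothing of Bałaban's analysis re-proved; `HThm4Rec`
UNDISCHARGED; caveat (C-S3-1) + addendum v4 stand; N05 [B8] DISCHARGED OF RECORD untouched; COUNT of record unmoved · K numerically unchanged; one finite `𝕋⁴` programme at fixed
`ε`, Bałaban AS PRINTED; nothing continuum ∕ ℝ⁴ ∕ OS ∕ mass-gap ∕ Clay.  No `sorry`, no `def`.

[cite: Balaban1985RegularSpaces, Prop. 6 (1.135)–(1.138) p.99, p.99, (1.132)–(1.133) p.99, (1.33)–(1.35) p.82, (1.66) p.87, (1.15) p.78, Thm 4 p.88; Balaban1985Variational, (148)–(153) p.301; Balaban1987RG1, (0.3)–(0.4) pp.252–253]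
-/

noncomputable section

open NormedSpace

namespace Literature.MathematicalPhysics.QuantumFieldTheory.Balaban1983to89.B8Prop6DentedCubeMemberGammaRec

open B7Prop1Explicit B7Prop2Explicit B7Prop1Local
open B7Eq92Concrete (mgauge mgauge_apply mgauge_one_left)
open B7Prop2Explicit (c2' unitaryUnits unitaryUnits_le_U1)
open B7Prop2Rec (AvgClosedZ C0Z avgClosedZ_unitaryUnits)
open BlockAveragingZd (avgIterZ ctrShift)
open B7SectEFLinearisationRec (linCovIterZ)
open B8Ineq130Rec (tlo thi tlo_le_thi)
open B8Ineq132 (covDerivFwd InAk BondTouches condAt_anti)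
open B8Ineq132Rec (pdevOn_lt_of_inAk_box)
open B8Ineq133Rec (cutFixedZ ineq133)
open B8Eq115GaugeFixingRec (localGaugeZ)
open B8Eq119TwistedAxialRec (InAxZ Restr129Z inAxZ_one_iff inAxOneZ_of_tower)
open B8Eq184Proof (gaugeExp cfgExp)
open B8Lemma1NonAbelian (mulCfg)
open B8Lemma1NonAbelianRecLoops (halfVec)
open B8Eq140Level (SideTouches)
open B8Eq146AExpansion (iEta)
open B8Eq155JBound (Jcur wsup)
open B8ScaledSupNorm (bondNorm msup)
open B8Eq138LandauZd (logCfg)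
open B8Eq138LandauZdRec (IsLandau138WZ)
open B8Eq131Cubes (tLo tHi ctr ctr_mem two_crad_le tLo_le_tHi)
open B8Eq131CubesRec (sq_le_tilde)
open B8Eq131CubesAdmissibleRec (cubeFamZ)
open B8Prop6OfThm4 (one_inAk agree135)
open B8Prop6OfThm4Rec (localGaugeZ_mem)
open B8Prop6CubeMemberRec (tlo_tlo thi_thi)
open B8Ineq133CubeMemberGammaRec (thm4_hypotheses_one_cutFixedZ_γ)
open B8Thm4ExistsAtGammaRec (thm4Exists_concrete_at_γ)
open B9SupplySockB9P3ZdBeta (CrossB)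
open B8DentedCubeMemberZdRec (lamST_of_lt lamST_top_apply inBox_sq_of_mem_lamST hΩ_sq lamBPT_hbox_pred lamBPT_hclass bdryLayer_dented)
open Node00 (CubeB8DZ)

export B7Prop1Explicit (Site)

variable {d : ℕ}

/-! ## §1 «the assumptions of Theorem 4 are satisfied for the pair 1, U₀″» ON THE DENTED RECORD TOWER -/

section Hypotheses

variable {L s K : ℕ} {Ω : ℕ → Set (Site d)}
variable {𝔸 : Type*} [CStarAlgebra 𝔸] [Nontrivial 𝔸]

/-- ★ **`Ax` AT EVERY TRUNCATION W.R.T. THE DENTED RECORD CELLS** for the pair `(1, U₀″·1)`: (1.15) holds for `U₀″` on the WHOLE centred tower `□̃^{(·)}` (dag-n05-d's `ineq133`), and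
every dented truncated cell label of level `j` lies in its centred box `□_j^{(j)} ⊂ □̃^{(j)}` (`inBox_sq_of_mem_lamST`, `sq_le_tilde`), so the sub-tower below depth `k − m`
gives `InAxZ L m (c.lamST m) 1 (U₀″·1)` (`inAxOneZ_of_tower`) — (b)-1's argument for the pure cells, verbatim for the dented ones; replaces the engine's cover lemma.
[cite: Balaban1985RegularSpaces, (1.15) p.78, (1.132)–(1.133) p.99, (1.19)–(1.20) p.79; Balaban1985Variational, (151) p.301; Balaban1987RG1, (0.3)–(0.4) pp.252–253] -/
theorem inAxZ_lamST_cutFixedZ (hLs : L = 2 * s + 1) (hs : 1 ≤ s) (hd : 1 ≤ d) (c : CubeB8DZ d L K Ω)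
    (U : Site d → Fin d → 𝔸ˣ) (hU : ∀ x κ, U x κ ∈ unitaryUnits 𝔸) {α₀ : ℝ} (hα : 0 < α₀)
    (hα3 : C0Z d * (α₀ * (L : ℝ) ^ 2) ≤ 1 / 3) (hα2 : 2 * (α₀ * (L : ℝ) ^ 2) ≤ c2' d L)
    {η : ℝ} (hA : InAk L c.k η α₀ Ω U)
    (hsmall : 11 * (d : ℝ) ^ 2 * (L : ℝ) ^ 2 * α₀ + ((c.M : ℝ) + 4 * c.ρ) * d * (L : ℝ) ^ 2 * α₀ ≤ 1 / 6) :
    ∀ m, m ≤ c.k → InAxZ L m (c.lamST m) (1 : Site d → Fin d → 𝔸ˣ)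
      (mulCfg (cutFixedZ L (tLo c.a c.ρ) (tHi c.a c.M c.ρ) U c.k (ctr c.a c.M)) (1 : Site d → Fin d → 𝔸ˣ)) := by
  have hLo : Odd L := ⟨s, hLs⟩
  have hL : 2 ≤ L := by omega
  have hL1 : 1 ≤ L := by omega
  have hρ : 1 ≤ c.ρ := hL1.trans c.L_le_ρ
  have hM1 : 1 ≤ c.M := hρ.trans c.ρ_le_M
  have hM : 11 * (d : ℝ) < c.M := by exact_mod_cast c.big
  have hG := avgClosedZ_unitaryUnits (𝔸 := 𝔸) d L
  set W := cutFixedZ L (tLo c.a c.ρ) (tHi c.a c.M c.ρ) U c.k (ctr c.a c.M) with hW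
  have hW1 : mulCfg W (1 : Site d → Fin d → 𝔸ˣ) = W := by funext x μ; simp [mulCfg]
  obtain ⟨hy, hy', hrad⟩ := ctr_mem (a := c.a) (ρ := c.ρ) hM1
  have hRM : (c.ρ : ℝ) * 1 ≤ (c.M : ℝ) := by rw [mul_one]; exact_mod_cast c.ρ_le_M
  have hsmall' : 11 * (d : ℝ) ^ 2 * (L : ℝ) ^ 2 * α₀ + ((c.M : ℝ) + 4 * c.ρ * 1) * d * (L : ℝ) ^ 2 * α₀ ≤ 1 / 6 := by rwa [mul_one]
  have hΩ : ∃ l, l ≤ c.k ∧ c.k ≤ l + 1 ∧ ∀ x, InBox (tlo L (tLo c.a c.ρ) c.k) (thi L (tHi c.a c.M c.ρ) c.k) x → x ∈ Ω l :=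
    ⟨c.k - 1, Nat.sub_le _ _, by omega, fun x hx => c.tcube_sub hx⟩
  have h17 := pdevOn_lt_of_inAk_box hL1 hα hA hΩ
  obtain ⟨-, -, -, h15, -, -⟩ := ineq133 hLs hL hd hG c.k U hU hα hα3 hα2 (tLo c.a c.ρ) (tHi c.a c.M c.ρ) (tLo_le_tHi hM1) h17 hy hy' hrad
    (two_crad_le c.M c.ρ) hRM hM hsmall'
  intro m hm
  rw [hW1, inAxZ_one_iff]
  refine inAxOneZ_of_tower hLo (lo := tlo L (tLo c.a c.ρ) (c.k - m)) (hi := thi L (tHi c.a c.M c.ρ) (c.k - m)) (fun n hn z hz hz' r => ?_)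
    (fun j hj1 hjm x hx => ?_)
  · rw [tlo_tlo] at hz
    rw [thi_thi] at hz'
    have h := h15 (c.k - m + n) (by omega) z hz hz' r
    rwa [show c.k - (c.k - m + n + 1) = m - (n + 1) by omega] at h
  · have hsq := inBox_sq_of_mem_lamST c hx
    obtain ⟨h1, h2⟩ := sq_le_tilde hLo hL c.a c.M c.ρ c.k j
    rw [tlo_tlo, thi_thi, show c.k - m + (m - j) = c.k - j by omega]
    exact ⟨fun i => (h1 i).trans (hsq i).1, fun i => (hsq i).2.trans (h2 i)⟩

/-- ★ (RECORD TWIN of `B8Prop6DentedCubeMemberGamma.thm4_hypotheses_one_cutFixed_dented_γ`.) **THE p. 99 ∕ (151) SENTENCE AT THE DENTED RECORD MEMBER IN THE CURRENCY OF THE γ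
DRIVER**: `U₀″` unitary-valued; (1.33) for `1` on `{Ω′_j}`; (1.34)∕(151) `U₀″ ∈ 𝔄_k({Ω′_j}, L³α₀)` (from `𝔄_k({□_j}, L³α₀)` by `Ω′_j ⊆ □_j`); `Ax` at every truncation w.r.t. the dented
record cells (`inAxZ_lamST_cutFixedZ`); (1.35)∕(1.66) for every level-`j` bond whose CENTRED box lies in `Ω′_{j−1} ⊆ □_{j−1}`; (1.66) on the sides touching `Ω′₀ = □₀`.
[cite: Balaban1985RegularSpaces, p.99 (sentence after (1.133)), (1.132)–(1.133) p.99, (1.33)–(1.35) p.82, (1.66) p.87; Balaban1985Variational, (151) p.301; Balaban1987RG1, (0.3)–(0.4) pp.252–253] -/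
theorem thm4_hypotheses_one_cutFixed_dented_γ (hLs : L = 2 * s + 1) (hs : 1 ≤ s) (hd : 1 ≤ d) (c : CubeB8DZ d L K Ω)
    (U : Site d → Fin d → 𝔸ˣ) (hU : ∀ x κ, U x κ ∈ unitaryUnits 𝔸) {α₀ : ℝ} (hα : 0 < α₀)
    (hα3 : C0Z d * (α₀ * (L : ℝ) ^ 2) ≤ 1 / 3) (hα2 : 2 * (α₀ * (L : ℝ) ^ 2) ≤ c2' d L)
    {η : ℝ} (hη : 0 < η) (hA : InAk L c.k η α₀ Ω U)
    (hsmall : 11 * (d : ℝ) ^ 2 * (L : ℝ) ^ 2 * α₀ + ((c.M : ℝ) + 4 * c.ρ) * d * (L : ℝ) ^ 2 * α₀ ≤ 1 / 6) :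
    (∀ x κ, cutFixedZ L (tLo c.a c.ρ) (tHi c.a c.M c.ρ) U c.k (ctr c.a c.M) x κ ∈ unitaryUnits 𝔸) ∧
    InAk L c.k η ((L : ℝ) ^ 3 * α₀) c.sq (1 : Site d → Fin d → 𝔸ˣ) ∧
    InAk L c.k η ((L : ℝ) ^ 3 * α₀) c.sq (mulCfg (cutFixedZ L (tLo c.a c.ρ) (tHi c.a c.M c.ρ) U c.k (ctr c.a c.M)) (1 : Site d → Fin d → 𝔸ˣ)) ∧
    (∀ m, m ≤ c.k → InAxZ L m (c.lamST m) (1 : Site d → Fin d → 𝔸ˣ)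
      (mulCfg (cutFixedZ L (tLo c.a c.ρ) (tHi c.a c.M c.ρ) U c.k (ctr c.a c.M)) (1 : Site d → Fin d → 𝔸ˣ))) ∧
    (∀ j, j ≤ c.k → ∀ (z : Site d) (μ : Fin d),
      (∀ x, InBox (fun i => (L : ℤ) ^ j * z i - (ctrShift L j : ℤ)) (fun i => (L : ℤ) ^ j * z i + (ctrShift L j : ℤ) + if i = μ then (L : ℤ) ^ j else 0) x →
        x ∈ c.sq (j - 1)) →
        ‖(avgIterZ L (mulCfg (cutFixedZ L (tLo c.a c.ρ) (tHi c.a c.M c.ρ) U c.k (ctr c.a c.M)) (1 : Site d → Fin d → 𝔸ˣ)) j z μ : 𝔸) -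
            (avgIterZ L (1 : Site d → Fin d → 𝔸ˣ) j z μ : 𝔸)‖ ≤ 6 * d * (L : ℝ) ^ 2 * c.M * α₀) ∧
    (∀ b ∈ {b : Site d × Fin d | SideTouches (c.sq 0) b.1 b.2},
      ‖((cutFixedZ L (tLo c.a c.ρ) (tHi c.a c.M c.ρ) U c.k (ctr c.a c.M) b.1 b.2 : 𝔸ˣ) : 𝔸) - 1‖ ≤ 6 * d * (L : ℝ) ^ 2 * c.M * α₀) := by
  have hL : 2 ≤ L := by omega
  have hL1 : 1 ≤ L := by omega
  have hρ : 1 ≤ c.ρ := hL1.trans c.L_le_ρ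
  have hM : 11 * (d : ℝ) < c.M := by exact_mod_cast c.big
  have hLpos : (0 : ℝ) < L := by exact_mod_cast (show 0 < L by omega)
  have hα₀' : 0 < (L : ℝ) ^ 3 * α₀ := by positivity
  obtain ⟨hmem, -, h34, -, h135, h66⟩ :=
    thm4_hypotheses_one_cutFixedZ_γ hLs hL hd c.k U hU hα hα3 hα2 c.a hρ c.ρ_le_M hM hη hA c.tcube_sub hsmall
  exact ⟨hmem, one_inAk hL1 c.k hη hα₀' c.sq, fun j hj => condAt_anti (c.sq_subset_cubeFam j) (h34 j hj),
    inAxZ_lamST_cutFixedZ hLs hs hd c U hU hα hα3 hα2 hA hsmall,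
    fun j hj z μ hbox => h135 j hj z μ (fun x hx => c.sq_subset_cubeFam (j - 1) (hbox x hx)), fun b _ => h66 b.1 b.2⟩

end Hypotheses

/-! ## §2 PROPOSITION 6 ∕ (152)–(153) at the dented RECORD member, background `1`, modulo the three existence bodies — edition γ -/

section Prop6

variable {𝔸 : Type} [CStarAlgebra 𝔸] [Nontrivial 𝔸]

/-- ★★ (RECORD TWIN of `B8Prop6DentedCubeMemberGamma.prop6_exists_dentedMember_at_γ₃`.) **PROPOSITION 6 (p. 99) ∕ [15] (152)–(153) AT THE DENTED RECORD CUBE MEMBER, MODULO THE THREE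
EXISTENCE BODIES AT THE FLAT DATUM `(1, U₀″)`, EDITION γ, CENTRED AVERAGING** — the engine statement under the token map (`CubeB8DZ`, `cutFixedZ`, `localGaugeZ`, `Restr129Z`,
`IsLandau138WZ`, `linCovIterZ`, `C0Z`, centred `□̃`): Prop. 6's conclusion on [15]'s local sequence `{Ω′_j}`: tower `c.sq`, truncated cells `c.lamST` (`c.lamS` at the top), averaging index of
the (1.59) body `c.lamBPT m ∪ {level-0 crossing bonds of □₀}`; the side conditions `L ≤ ρ ≤ M`, `11d < M`, `□̃ ⊂ Ω_{k−1}` are the fields of `c`, the ambient family `{Ω_j}` is `c`'s.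
ONE threshold `c₁ > 0` (the γ driver's); for every dented datum at which the three bodies hold, every unitary `U₀ ∈ 𝔄_k({Ω_j}, α₀)` in the regime of (1.130) with
`L³α₀ + 6dL²Mα₀ ≤ c₁`: THERE IS a unitary `u`, `= 1` off `□₀`, with (1.29)∕(152) «ū_j = 1 on Λ′_j» for the DENTED cells, such that `U₁ := U₀″^{u⁻¹}` satisfies the Landau gauge
of record (1.38)∕(153) for `{Ω′_j}` and (1.62): `U₁ = e^{iηA}`, `A` Hermitian, `|A_b| ≤ 5dLB₀(L³α₀ + 6dL²Mα₀)(Lʲη)⁻¹` on the bonds of the plaquettes touching `Ω′_j`; and (1.135):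
`w := v⁻¹u` unitary, `U₀^{w⁻¹} = U₁` on `□̃`.  Driver `B8Thm4ExistsAtGammaRec.thm4Exists_concrete_at_γ` fed by `B8DentedCubeMemberZdRec.{lamBPT_hbox_pred, lamBPT_hclass, bdryLayer_dented}` and §2.
[cite: Balaban1985RegularSpaces, Prop. 6 (1.135)–(1.136) p.99, p.99 (sentence after (1.133)), Thm 4 p.88 (existence), Prop. 5 (1.107)–(1.108) p.94, (1.58)–(1.59) p.86, (1.31) p.82; Balaban1985Variational, (148)–(153) p.301; Balaban1984PropagatorsII, (2.3) p.224] -/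
theorem prop6_exists_dentedMember_at_γ₃ (hd2 : 2 ≤ d) {L s : ℕ} (hLs : L = 2 * s + 1) (hs : 1 ≤ s) {B₀ B₀' Bbd : ℝ} (hB₀ : 0 < B₀) (hB₀' : 0 < B₀')
    (hB : 2 ≤ 5 * (d : ℝ) * L * B₀) (hBbd : 0 ≤ Bbd) (hBd : 4 * Bbd ≤ ((d : ℝ) * L - 1) * B₀) :
    ∃ c₁ : ℝ, 0 < c₁ ∧ ∀ (η : ℝ), 0 < η → ∀ {K : ℕ} {Ω : ℕ → Set (Site d)} (c : CubeB8DZ d L K Ω),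
      ∀ (U₀ : Site d → Fin d → 𝔸ˣ), (∀ x κ, U₀ x κ ∈ unitaryUnits 𝔸) → ∀ (α₀ : ℝ), 0 < α₀ →
      C0Z d * (α₀ * (L : ℝ) ^ 2) ≤ 1 / 3 → 2 * (α₀ * (L : ℝ) ^ 2) ≤ c2' d L →
      InAk L c.k η α₀ Ω U₀ →
      11 * (d : ℝ) ^ 2 * (L : ℝ) ^ 2 * α₀ + ((c.M : ℝ) + 4 * c.ρ) * d * (L : ℝ) ^ 2 * α₀ ≤ 1 / 6 →
      (L : ℝ) ^ 3 * α₀ + 6 * d * (L : ℝ) ^ 2 * c.M * α₀ ≤ c₁ →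
      ((∃ (v : Site d → 𝔸ˣ) (lam : Site d → 𝔸), (∀ x, v x ∈ unitaryUnits 𝔸) ∧ (∀ x, x ∉ c.sq 0 → v x = 1) ∧
        (∀ j, j ≤ 1 → ∀ b ∈ {b : Site d × Fin d | SideTouches (c.sq j) b.1 b.2}, (v b.1 : 𝔸) = ((gaugeExp lam b.1 : 𝔸ˣ) : 𝔸) ∧
        (v (b.1 + e b.2) : 𝔸) = ((gaugeExp lam (b.1 + e b.2) : 𝔸ˣ) : 𝔸)) ∧
        (∀ j, j ≤ 1 → ∀ b ∈ {b : Site d × Fin d | SideTouches (c.sq j) b.1 b.2},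
        ‖lam b.1‖ ≤ (8 * B₀' * (5 * (d : ℝ) * L * B₀) * (((L : ℝ) ^ 3 * α₀) + (6 * d * (L : ℝ) ^ 2 * c.M * α₀))) ∧
          ((L : ℝ) ^ j * η) * ‖covDerivFwd η (1 : Site d → Fin d →
          𝔸ˣ) b.2 lam b.1‖ ≤ (8 * B₀' * (5 * (d : ℝ) * L * B₀) * (((L : ℝ) ^ 3 * α₀) + (6 * d * (L : ℝ) ^ 2 * c.M * α₀)))) ∧
        IsLandau138WZ L 1 η (c.sq 0) (c.lamST 1) (1 : Site d → Fin d → 𝔸ˣ) (mgauge (1 : Site d → Fin d →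
          𝔸ˣ) v⁻¹ (cutFixedZ L (tLo c.a c.ρ) (tHi c.a c.M c.ρ) U₀ c.k (ctr c.a c.M))) ∧ Restr129Z L 1 (c.lamST 1) (1 : Site d → Fin d → 𝔸ˣ) ((1 : Site d →
          𝔸ˣ) * v))) →
      ((∀ m, 1 ≤ m → m < c.k → ∀ (u₁ : Site d → 𝔸ˣ) (U₁ : Site d → Fin d → 𝔸ˣ) (A : Site d → Fin d → 𝔸),
        (∀ x, u₁ x ∈ unitaryUnits 𝔸) → (∀ x, x ∉ c.sq 0 → u₁ x = 1) → mgauge (1 : Site d → Fin d →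
          𝔸ˣ) u₁ U₁ = (cutFixedZ L (tLo c.a c.ρ) (tHi c.a c.M c.ρ) U₀ c.k (ctr c.a c.M)) → Restr129Z L m (c.lamST m) (1 : Site d → Fin d → 𝔸ˣ) u₁ →
        IsLandau138WZ L m η (c.sq 0) (c.lamST m) (1 : Site d → Fin d → 𝔸ˣ) U₁ →
        (∀ j, j ≤ m → ∀ b ∈ {b : Site d × Fin d | SideTouches (c.sq j) b.1 b.2},
        U₁ b.1 b.2 = cfgExp η A b.1 b.2 ∧ IsSelfAdjoint (A b.1 b.2) ∧
          ‖A b.1 b.2‖ ≤ (5 * (d : ℝ) * L * B₀ * (((L : ℝ) ^ 3 * α₀) + (6 * d * (L : ℝ) ^ 2 * c.M * α₀))) * ((L : ℝ) ^ j * η)⁻¹) →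
        ∃ (v : Site d → 𝔸ˣ) (lam : Site d → 𝔸), (∀ x, v x ∈ unitaryUnits 𝔸) ∧ (∀ x, x ∉ c.sq 0 → v x = 1) ∧
        (∀ j, j ≤ m + 1 →
          ∀ b ∈ {b : Site d × Fin d | SideTouches (c.sq j) b.1 b.2}, (v b.1 : 𝔸) = ((gaugeExp lam b.1 : 𝔸ˣ) : 𝔸) ∧
        (v (b.1 + e b.2) : 𝔸) = ((gaugeExp lam (b.1 + e b.2) : 𝔸ˣ) : 𝔸)) ∧
        (∀ j, j ≤ m + 1 → ∀ b ∈ {b : Site d × Fin d | SideTouches (c.sq j) b.1 b.2},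
        ‖lam b.1‖ ≤ (8 * B₀' * (5 * (d : ℝ) * L * B₀) * (((L : ℝ) ^ 3 * α₀) + (6 * d * (L : ℝ) ^ 2 * c.M * α₀))) ∧
          ((L : ℝ) ^ j * η) * ‖covDerivFwd η (1 : Site d → Fin d →
          𝔸ˣ) b.2 lam b.1‖ ≤ (8 * B₀' * (5 * (d : ℝ) * L * B₀) * (((L : ℝ) ^ 3 * α₀) + (6 * d * (L : ℝ) ^ 2 * c.M * α₀)))) ∧
        IsLandau138WZ L (m + 1) η (c.sq 0) (c.lamST (m + 1)) (1 : Site d → Fin d → 𝔸ˣ) (mgauge (1 : Site d → Fin d →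
          𝔸ˣ) v⁻¹ U₁) ∧ Restr129Z L (m + 1) (c.lamST (m + 1)) (1 : Site d → Fin d → 𝔸ˣ) (u₁ * v))) →
      ((∀ m, 1 ≤ m → m ≤ c.k → ∀ (u : Site d → 𝔸ˣ) (W : Site d → Fin d → 𝔸ˣ) (A' : Site d → Fin d → 𝔸),
        (∀ x, u x ∈ unitaryUnits 𝔸) → (∀ x, x ∉ c.sq 0 → u x = 1) →
          mgauge (1 : Site d → Fin d → 𝔸ˣ) u W = (cutFixedZ L (tLo c.a c.ρ) (tHi c.a c.M c.ρ) U₀ c.k (ctr c.a c.M)) →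
          Restr129Z L m (c.lamST m) (1 : Site d → Fin d → 𝔸ˣ) u →
          IsLandau138WZ L m η (c.sq 0) (c.lamST m) (1 : Site d → Fin d → 𝔸ˣ) W →
        (∀ y τ, IsSelfAdjoint (A' y τ)) →
        (∀ j, j ≤ m → ∀ y τ, SideTouches (c.sq j) y τ →
        W y τ = cfgExp η A' y τ ∧
          ‖A' y τ‖ ≤ (2 * (L * (5 * (d : ℝ) * L * B₀ * (((L : ℝ) ^ 3 * α₀) + (6 * d * (L : ℝ) ^ 2 * c.M * α₀)))) + 8 * (8 * B₀' * (5 * (d : ℝ) * L * B₀) * (((L : ℝ) ^ 3 * α₀) + (6 * d * (L : ℝ) ^ 2 * c.M * α₀)))) * ((L : ℝ) ^ j * η)⁻¹) →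
        (∀ y τ, (∀ j, j ≤ m → ¬ SideTouches (c.sq j) y τ) → A' y τ = 0) →
        msup L m η (-(1 : ℝ)) (fun j (b : Site d × Fin d) => SideTouches (c.sq j) b.1 b.2) (fun b => A' b.1 b.2)
        ≤ B₀ * (bondNorm L m η (-(3 : ℝ)) c.sq (fun x μ => Jcur η (1 : Site d → Fin d → 𝔸ˣ) A' μ x)
        + wsup 1 (fun p : {p : ℕ × (Site d × Fin d) // p.1 ≤ m ∧ (p.2 ∈ c.lamBPT m p.1 ∨ (p.1 = 0 ∧ CrossB (c.sq 0) p.2))} =>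
        linCovIterZ L (1 : Site d → Fin d → 𝔸ˣ) (iEta η A') p.1.1 p.1.2.1 p.1.2.2))
        + Bbd * msup L m η (-(1 : ℝ)) (fun j (b : Site d × Fin d) => j = 0 ∧ SideTouches (c.sq 0) b.1 b.2 ∧
            ¬ BondTouches (c.sq 0) b.1 b.2) (fun b => A' b.1 b.2) ∧
        msup L m η (-(2 : ℝ)) (fun j (t : Fin d × Fin d × Site d) => SideTouches (c.sq j) t.2.2 t.2.1)
        (fun t => covDerivFwd η (1 : Site d → Fin d → 𝔸ˣ) t.1 (fun z => A' z t.2.1) t.2.2)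
        ≤ B₀ * (bondNorm L m η (-(3 : ℝ)) c.sq (fun x μ => Jcur η (1 : Site d → Fin d → 𝔸ˣ) A' μ x)
        + wsup 1 (fun p : {p : ℕ × (Site d × Fin d) // p.1 ≤ m ∧ (p.2 ∈ c.lamBPT m p.1 ∨ (p.1 = 0 ∧ CrossB (c.sq 0) p.2))} =>
        linCovIterZ L (1 : Site d → Fin d → 𝔸ˣ) (iEta η A') p.1.1 p.1.2.1 p.1.2.2))
        + Bbd * msup L m η (-(1 : ℝ)) (fun j (b : Site d × Fin d) => j = 0 ∧ SideTouches (c.sq 0) b.1 b.2 ∧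
            ¬ BondTouches (c.sq 0) b.1 b.2) (fun b => A' b.1 b.2))) →
      ∃ u : Site d → 𝔸ˣ, (∀ x, u x ∈ unitaryUnits 𝔸) ∧ (∀ x, x ∉ c.sq 0 → u x = 1) ∧
        Restr129Z L c.k c.lamS (1 : Site d → Fin d → 𝔸ˣ) u ∧
        IsLandau138WZ L c.k η (c.sq 0) c.lamS (1 : Site d → Fin d → 𝔸ˣ)
          (gaugeAct u⁻¹ (cutFixedZ L (tLo c.a c.ρ) (tHi c.a c.M c.ρ) U₀ c.k (ctr c.a c.M))) ∧
        (∀ j, j ≤ c.k → ∀ b ∈ {b : Site d × Fin d | SideTouches (c.sq j) b.1 b.2},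
          gaugeAct u⁻¹ (cutFixedZ L (tLo c.a c.ρ) (tHi c.a c.M c.ρ) U₀ c.k (ctr c.a c.M)) b.1 b.2 =
              cfgExp η (logCfg η (gaugeAct u⁻¹ (cutFixedZ L (tLo c.a c.ρ) (tHi c.a c.M c.ρ) U₀ c.k (ctr c.a c.M)))) b.1 b.2 ∧
            IsSelfAdjoint (logCfg η (gaugeAct u⁻¹ (cutFixedZ L (tLo c.a c.ρ) (tHi c.a c.M c.ρ) U₀ c.k (ctr c.a c.M))) b.1 b.2) ∧
            ‖logCfg η (gaugeAct u⁻¹ (cutFixedZ L (tLo c.a c.ρ) (tHi c.a c.M c.ρ) U₀ c.k (ctr c.a c.M))) b.1 b.2‖ ≤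
              (5 * (d : ℝ) * L * B₀ * ((L : ℝ) ^ 3 * α₀ + 6 * d * (L : ℝ) ^ 2 * c.M * α₀)) * ((L : ℝ) ^ j * η)⁻¹) ∧
        (∀ x, ((localGaugeZ L (tLo c.a c.ρ) (tHi c.a c.M c.ρ) U₀ c.k (ctr c.a c.M))⁻¹ * u) x ∈ unitaryUnits 𝔸) ∧
        AgreeOn (B8Ineq130Rec.tlo L (tLo c.a c.ρ) c.k) (B8Ineq130Rec.thi L (tHi c.a c.M c.ρ) c.k)
          (gaugeAct ((localGaugeZ L (tLo c.a c.ρ) (tHi c.a c.M c.ρ) U₀ c.k (ctr c.a c.M))⁻¹ * u)⁻¹ U₀)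
          (gaugeAct u⁻¹ (cutFixedZ L (tLo c.a c.ρ) (tHi c.a c.M c.ρ) U₀ c.k (ctr c.a c.M))) := by
  have hL1 : 1 ≤ L := by omega
  have hL : 2 ≤ L := by omega
  have hLo : Odd L := ⟨s, hLs⟩
  have hd1 : 1 ≤ d := le_trans (by norm_num) hd2
  obtain ⟨c₁, hc₁, H⟩ := thm4Exists_concrete_at_γ (𝔸 := 𝔸) hd2 hLs hs hB₀ hB₀' hB hBbd hBd
  refine ⟨c₁, hc₁, ?_⟩
  intro η hη K Ω c U₀ hU₀ α₀ hα hα3 hα2 hA hsmall hc P5base₁ P5step₁ H59Dβ₁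
  have hk : 1 ≤ c.k := c.one_le_k
  have hρ : 1 ≤ c.ρ := hL1.trans c.L_le_ρ
  have hM1 : 1 ≤ c.M := hρ.trans c.ρ_le_M
  have hLpos : (0 : ℝ) < L := by exact_mod_cast lt_of_lt_of_le (by norm_num) hL
  have hdpos : (0 : ℝ) < d := by exact_mod_cast hd1
  have hMpos : (0 : ℝ) < c.M := by exact_mod_cast hM1
  have hα₀' : 0 < (L : ℝ) ^ 3 * α₀ := by positivity
  have hα₁' : 0 < 6 * (d : ℝ) * (L : ℝ) ^ 2 * c.M * α₀ := by positivity
  obtain ⟨hmem, h33, h34, hAx, h135, h66⟩ :=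
    thm4_hypotheses_one_cutFixed_dented_γ hLs hs hd1 c U₀ hU₀ hα hα3 hα2 hη hA hsmall
  have hone : ∀ x κ, (1 : Site d → Fin d → 𝔸ˣ) x κ ∈ unitaryUnits 𝔸 := fun _ _ => (unitaryUnits 𝔸).one_mem
  obtain ⟨u, hu, huS, h129, hLan, h162⟩ := H η hη c.k c.sq (hΩ_sq c hLo) c.lamST c.lamBPT (lamBPT_hbox_pred c hLs) (lamBPT_hclass c hLs)
    (bdryLayer_dented c hLs hs) _ _ hα₀' hα₁' hc 1 _ hone hmem h33 h34 hAx h135 h66 P5base₁ P5step₁ H59Dβ₁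
  simp only [mgauge_one_left] at hLan h162
  have htop : c.lamST c.k = c.lamS := funext (lamST_top_apply c)
  rw [htop] at h129 hLan
  have hΩ' : ∃ l, l ≤ c.k ∧ c.k ≤ l + 1 ∧ ∀ x, InBox (B8Ineq130Rec.tlo L (tLo c.a c.ρ) c.k) (B8Ineq130Rec.thi L (tHi c.a c.M c.ρ) c.k) x → x ∈ Ω l :=
    ⟨c.k - 1, Nat.sub_le _ _, by omega, fun x hx => c.tcube_sub hx⟩
  have hvG : ∀ x, localGaugeZ L (tLo c.a c.ρ) (tHi c.a c.M c.ρ) U₀ c.k (ctr c.a c.M) x ∈ unitaryUnits 𝔸 :=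
    localGaugeZ_mem hLs hL (avgClosedZ_unitaryUnits (𝔸 := 𝔸) d L) c.k U₀ hU₀ hα hα3 hα2 (tLo_le_tHi hM1)
      (pdevOn_lt_of_inAk_box hL1 hα hA hΩ') (ctr c.a c.M)
  exact ⟨u, hu, huS, h129, hLan hk, h162, fun x => (unitaryUnits 𝔸).mul_mem ((unitaryUnits 𝔸).inv_mem (hvG x)) (hu x),
    agree135 _ _ U₀ _ u⟩


#print axioms prop6_exists_dentedMember_at_γ₃

end Prop6

end Literature.MathematicalPhysics.QuantumFieldTheory.Balaban1983to89.B8Prop6DentedCubeMemberGammaRec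

end
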